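import Summits.Parity.BatemanHorn.Theorems.AlmostPrimeZerosSystemLSDRealSegmentReductionCore
import HarnessLib

/-!
# Route `AlmostPrimeZeros`, crux `SystemLSDRealSegment` (stmt-Parity-11292), line `beta-thinned-root-kernel`:
# domination of the twisted smooth divisor sums (`stub_twistedDivisorSum_domination`)

In the Rankin step of the smooth-kernel estimate the row `n` contributes the product `∏ᵢ T(mᵢ)` of the TWISTED
SMOOTH DIVISOR SUMS `T(m) = Σ_{e ∣ m, e S-smooth} h_y(e) e^δ` at the values `mᵢ = fᵢ(n) ≥ 1` (`h_y = thinWeight y`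
of `…/AlmostPrimeZerosDefs.lean`; `divSet m = m.divisors` for `m ≠ 0`).  This file proves the registered stub
`stub_twistedDivisorSum_domination` of the checked skeleton
`Cruxes/SystemLSDRealSegment/Lines/beta_thinned_root_kernel.lean`:

1. `T` is multiplicative (`twistedSum_eq_factorization_prod`: the twisted smooth weight
   `e ↦ 1_{S-smooth}(e) h_y(e) e^δ` is a multiplicative arithmetic function and `T` is its Dirichlet product with
   `ζ`), `T(1) = 1`, `T(p) = 1 + (y − 1) p^δ` for `p < S`, `T(p) = 1` for `p ≥ S` (`twistedSum_prime`), and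
   `0 ≤ T(p^v) ≤ y² S^{2δ}` for `y ≥ 1`, `δ ≥ 0`, `S ≥ 1` (`twistedSum_prime_pow_le`).  Hence, prime by prime over
   `M = ∏ᵢ mᵢ`: `∏ᵢ T(mᵢ) ≤ G̃(M)` for the weight `G̃(M) = ∏_{p^v ∥ M} g(p, v)`, `g(p, 1) = T(p)` (exact at the
   simple prime factors of `M`: exactly one slot carries `p`, to the first power) and `g(p, v) = (y² S^{2δ})^k` for
   `v ≥ 2` (crude: each of the `k` slots is `≤ y² S^{2δ}`) — `twistedDivisorSum_le_weight`.
2. With `δ = 2 / log S`, `S ≥ 2` (so `S^δ = e²`, `S^{2δ} = e⁴`): `G̃ ≥ 0`, `G̃(1) = 1`, `G̃(MN) = G̃(M) G̃(N)` for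
   coprime `M, N`, and `G̃(p^v) ≤ (y² e⁴)^(k+1)` at prime powers — a Nair–Tenenbaum-light weight class whose
   constants do not depend on `S`.

Elementary multiplicative bookkeeping over Mathlib (`Nat.factorization`, `Nat.smoothNumbers`,
`ArithmeticFunction.IsMultiplicative`); no analytic input.  References: G. Tenenbaum, *Introduction to analytic
and probabilistic number theory* (2015) §III.5.1 (Rankin's method); M. Nair, G. Tenenbaum, *Short sums of certain
arithmetic functions*, Acta Math. 180 (1998).  Not here: the Rankin inequality itself and the Nair–Tenenbaum sum
bound (other stubs of the same skeleton).
-/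

open Filter Finset Polynomial
open scoped BigOperators

namespace Summit.Parity.BatemanHorn.Cruxes.SystemLSDRealSegment.BetaThinnedRootKernel

open Literature.NumberTheory.Sieve

noncomputable section

/-! ### Smoothness of primes and of prime powers

(`1 ∈ Nat.smoothNumbers S` is `Literature.NumberTheory.LFunctions.Halasz.one_mem_smoothNumbers`; to keep the import
closure of this elementary file small it is re-derived inline from `Nat.mem_smoothNumbers'` where needed.) -/

/-- A prime `p` is `S`-smooth iff `p < S`. [folklore] -/
theorem prime_mem_smoothNumbers_iff {p : ℕ} (hp : p.Prime) (S : ℕ) : p ∈ Nat.smoothNumbers S ↔ p < S := by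
  rw [Nat.mem_smoothNumbers']
  exact ⟨fun h => h p hp dvd_rfl, fun h q hq hqd => by rwa [(Nat.prime_dvd_prime_iff_eq hq hp).1 hqd]⟩

/-- For a prime `p` and `j ≠ 0`, `p^j` is `S`-smooth iff `p < S`. [folklore] -/
theorem prime_pow_mem_smoothNumbers_iff {p j : ℕ} (hp : p.Prime) (hj : j ≠ 0) (S : ℕ) :
    p ^ j ∈ Nat.smoothNumbers S ↔ p < S := by
  rw [Nat.mem_smoothNumbers']
  refine ⟨fun h => h p hp (dvd_pow_self p hj), fun h q hq hqd => ?_⟩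
  rwa [(Nat.prime_dvd_prime_iff_eq hq hp).1 (hq.dvd_of_dvd_pow hqd)]

/-! ### The twisted smooth divisor sum `T(m) = Σ_{e ∣ m, e S-smooth} h_y(e) e^δ` -/

/-- `T(m) ≥ 0` for `y ≥ 1` (all terms are `≥ 0`). [folklore] -/
theorem twistedSum_nonneg {y : ℝ} (hy : 1 ≤ y) (δ : ℝ) (S n : ℕ) :
    0 ≤ ∑ e ∈ (divSet n).filter (· ∈ Nat.smoothNumbers S), thinWeight y e * (e : ℝ) ^ δ :=
  Finset.sum_nonneg fun e _ => mul_nonneg (thinWeight_nonneg hy e) (Real.rpow_nonneg (Nat.cast_nonneg e) δ)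

/-- `T(1) = 1`. [folklore] -/
theorem twistedSum_one (y δ : ℝ) (S : ℕ) :
    (∑ e ∈ (divSet 1).filter (· ∈ Nat.smoothNumbers S), thinWeight y e * (e : ℝ) ^ δ) = 1 := by
  have h1S : 1 ∈ Nat.smoothNumbers S := Nat.mem_smoothNumbers'.2 fun _ hp h => (hp.ne_one (Nat.dvd_one.1 h)).elim
  rw [Finset.sum_filter, divSet, max_self, Nat.divisors_one, Finset.sum_singleton, if_pos h1S, thinWeight_one,
    Nat.cast_one, Real.one_rpow, mul_one]

/-- `T(p^v) = Σ_{j ≤ v} 1_{p^j S-smooth} · thinCoeff y j · (p^j)^δ` at a prime power. [folklore] -/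
theorem twistedSum_prime_pow (y δ : ℝ) (S : ℕ) {p : ℕ} (hp : p.Prime) (v : ℕ) :
    (∑ e ∈ (divSet (p ^ v)).filter (· ∈ Nat.smoothNumbers S), thinWeight y e * (e : ℝ) ^ δ) =
      ∑ j ∈ range (v + 1), if p ^ j ∈ Nat.smoothNumbers S then thinCoeff y j * ((p : ℝ) ^ j) ^ δ else 0 := by
  rw [Finset.sum_filter, divSet, max_eq_left (Nat.one_le_iff_ne_zero.2 (pow_ne_zero v hp.ne_zero)),
    Nat.sum_divisors_prime_pow hp]
  refine Finset.sum_congr rfl fun j _ => ?_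
  rw [thinWeight_prime_pow y hp, Nat.cast_pow]

/-- `T(p) = 1 + (y − 1) p^δ` if `p < S` and `T(p) = 1` if `p ≥ S` (then the only smooth divisor is `1`). [folklore] -/
theorem twistedSum_prime (y δ : ℝ) (S : ℕ) {p : ℕ} (hp : p.Prime) :
    (∑ e ∈ (divSet p).filter (· ∈ Nat.smoothNumbers S), thinWeight y e * (e : ℝ) ^ δ) =
      if p < S then 1 + (y - 1) * (p : ℝ) ^ δ else 1 := by
  have h1S : 1 ∈ Nat.smoothNumbers S := Nat.mem_smoothNumbers'.2 fun _ hp h => (hp.ne_one (Nat.dvd_one.1 h)).elim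
  have h := twistedSum_prime_pow y δ S hp 1
  rw [pow_one] at h
  rw [h, Finset.sum_range_succ, Finset.sum_range_one]
  simp only [pow_zero, pow_one, h1S, ite_true, thinCoeff_zero, thinCoeff_one, Real.one_rpow, mul_one]
  by_cases hpS : p < S
  · rw [if_pos hpS, if_pos ((prime_mem_smoothNumbers_iff hp S).2 hpS)]
  · rw [if_neg hpS, if_neg (mt (prime_mem_smoothNumbers_iff hp S).1 hpS), add_zero]

/-- `T(p^v) ≤ y² S^{2δ}` at every prime power, for `y ≥ 1`, `δ ≥ 0`, `S ≥ 1`: termwise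
`1_{p^j smooth} thinCoeff y j (p^j)^δ ≤ thinCoeff y j · S^{2δ}` (`thinCoeff y j = 0` for `j ≥ 3`, `p < S` as soon as a
`p^j`, `j ≥ 1`, is smooth), and `Σ_{j ≤ v} thinCoeff y j = y^{min(v,2)} ≤ y²`. [folklore] -/
theorem twistedSum_prime_pow_le {y δ : ℝ} (hy : 1 ≤ y) (hδ : 0 ≤ δ) {S : ℕ} (hS : 1 ≤ S) {p : ℕ} (hp : p.Prime)
    (v : ℕ) :
    (∑ e ∈ (divSet (p ^ v)).filter (· ∈ Nat.smoothNumbers S), thinWeight y e * (e : ℝ) ^ δ) ≤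
      y ^ 2 * (S : ℝ) ^ (2 * δ) := by
  have hS' : (1 : ℝ) ≤ S := Nat.one_le_cast.2 hS
  have hSδ : 0 ≤ (S : ℝ) ^ (2 * δ) := Real.rpow_nonneg (Nat.cast_nonneg S) _
  rw [twistedSum_prime_pow y δ S hp v]
  calc _ ≤ ∑ j ∈ range (v + 1), thinCoeff y j * (S : ℝ) ^ (2 * δ) := by
        refine Finset.sum_le_sum fun j _ => ?_
        split_ifs with hs
        · rcases Nat.lt_or_ge j 3 with hj3 | hj3
          · refine mul_le_mul_of_nonneg_left ?_ (thinCoeff_nonneg hy j)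
            rcases Nat.eq_zero_or_pos j with rfl | hj0
            · rw [pow_zero, Real.one_rpow]
              exact Real.one_le_rpow hS' (mul_nonneg zero_le_two hδ)
            · have hpS : (p : ℝ) ≤ S :=
                Nat.cast_le.2 ((prime_pow_mem_smoothNumbers_iff hp hj0.ne' S).1 hs).le
              calc ((p : ℝ) ^ j) ^ δ ≤ ((S : ℝ) ^ j) ^ δ :=
                    Real.rpow_le_rpow (by positivity) (pow_le_pow_left₀ (Nat.cast_nonneg p) hpS j) hδ
                _ ≤ ((S : ℝ) ^ 2) ^ δ :=
                    Real.rpow_le_rpow (by positivity) (pow_le_pow_right₀ hS' (by omega)) hδ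
                _ = (S : ℝ) ^ (2 * δ) := by rw [Real.rpow_mul (Nat.cast_nonneg S), Real.rpow_two]
          · rw [thinCoeff_of_three_le y hj3, zero_mul, zero_mul]
        · exact mul_nonneg (thinCoeff_nonneg hy j) hSδ
    _ = y ^ min v 2 * (S : ℝ) ^ (2 * δ) := by rw [← Finset.sum_mul, sum_thinCoeff_range']
    _ ≤ y ^ 2 * (S : ℝ) ^ (2 * δ) := mul_le_mul_of_nonneg_right (pow_le_pow_right₀ hy (min_le_right v 2)) hSδ

/-- `T` is multiplicative: `T(m) = ∏_{p^v ∥ m} T(p^v)` for `m ≠ 0` — the twisted smooth weight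
`e ↦ 1_{S-smooth}(e) h_y(e) e^δ` is a multiplicative arithmetic function (smoothness is closed under products and
divisors, `h_y` is multiplicative, `e ↦ e^δ` is completely multiplicative) and `T` is its Dirichlet product with `ζ`
(the template is `pow_capped_eq_sum_divisors`). [folklore] -/
theorem twistedSum_eq_factorization_prod (y δ : ℝ) (S : ℕ) {n : ℕ} (hn : n ≠ 0) :
    (∑ e ∈ (divSet n).filter (· ∈ Nat.smoothNumbers S), thinWeight y e * (e : ℝ) ^ δ) =
      n.factorization.prod fun p v =>
        ∑ e ∈ (divSet (p ^ v)).filter (· ∈ Nat.smoothNumbers S), thinWeight y e * (e : ℝ) ^ δ := by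
  -- the twisted smooth weight as an arithmetic function, built inline
  let A : ArithmeticFunction ℝ :=
    ⟨fun d => if d ∈ Nat.smoothNumbers S then thinWeight y d * (d : ℝ) ^ δ else 0,
      if_neg fun h => Nat.ne_zero_of_mem_smoothNumbers h rfl⟩
  have hA : ∀ d : ℕ, A d = if d ∈ Nat.smoothNumbers S then thinWeight y d * (d : ℝ) ^ δ else 0 := fun _ => rfl
  have hA_mult : A.IsMultiplicative := by
    refine ⟨?_, ?_⟩
    · rw [hA, if_pos (Nat.mem_smoothNumbers'.2 fun _ hp h => (hp.ne_one (Nat.dvd_one.1 h)).elim), thinWeight_one,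
        Nat.cast_one, Real.one_rpow, mul_one]
    · intro a b hab
      rw [hA, hA, hA]
      by_cases ha : a ∈ Nat.smoothNumbers S
      · by_cases hb : b ∈ Nat.smoothNumbers S
        · rw [if_pos (Nat.mul_mem_smoothNumbers ha hb), if_pos ha, if_pos hb, thinWeight_mul_of_coprime y hab,
            Nat.cast_mul, Real.mul_rpow (Nat.cast_nonneg a) (Nat.cast_nonneg b)]
          ring
        · rw [if_neg hb, mul_zero, if_neg fun h => hb (Nat.mem_smoothNumbers_of_dvd h (dvd_mul_left b a))]
      · rw [if_neg ha, zero_mul, if_neg fun h => ha (Nat.mem_smoothNumbers_of_dvd h (dvd_mul_right a b))]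
  -- `T = A * ζ` away from `0`
  have key : ∀ {m : ℕ}, m ≠ 0 → (A * (ArithmeticFunction.zeta : ArithmeticFunction ℝ)) m =
      ∑ e ∈ (divSet m).filter (· ∈ Nat.smoothNumbers S), thinWeight y e * (e : ℝ) ^ δ := by
    intro m hm
    rw [ArithmeticFunction.coe_mul_zeta_apply, Finset.sum_filter, divSet,
      max_eq_left (Nat.one_le_iff_ne_zero.2 hm)]
    exact Finset.sum_congr rfl fun d _ => hA d
  rw [← key hn, (hA_mult.mul ArithmeticFunction.isMultiplicative_zeta.natCast).multiplicative_factorization _ hn]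
  refine Finsupp.prod_congr fun p hp => key (pow_ne_zero _ ?_)
  rw [Nat.support_factorization] at hp
  exact (Nat.prime_of_mem_primeFactors hp).ne_zero

/-! ### Part (1): domination by the multiplicative weight of the product -/

/-- **Part (1)**: `∏ᵢ T(mᵢ) ≤ G̃(∏ᵢ mᵢ)` for `y ≥ 1`, `δ ≥ 0`, `S ≥ 1`, `mᵢ ≠ 0` — prime by prime over
`M = ∏ᵢ mᵢ` (`v_p(M) = Σᵢ v_p(mᵢ)`): at a simple prime factor of `M` exactly one slot carries `p`, to the first
power, and the slot product is `T(p) = g(p, 1)` exactly; at a repeated prime factor every one of the `k` slots is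
`≤ y² S^{2δ}`. [folklore] -/
theorem twistedDivisorSum_le_weight (k : ℕ) {y : ℝ} (hy : 1 ≤ y) {δ : ℝ} (hδ : 0 ≤ δ) {S : ℕ} (hS : 1 ≤ S)
    (m : Fin k → ℕ) (hm : ∀ i, m i ≠ 0) :
    (∏ i, ∑ e ∈ (divSet (m i)).filter (· ∈ Nat.smoothNumbers S), thinWeight y e * (e : ℝ) ^ δ) ≤
      (∏ i, m i).factorization.prod fun p v =>
        if v = 1 then (if p < S then 1 + (y - 1) * (p : ℝ) ^ δ else 1) else (y ^ 2 * (S : ℝ) ^ (2 * δ)) ^ k := by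
  have hM : (∏ i, m i) ≠ 0 := Finset.prod_ne_zero_iff.2 fun i _ => hm i
  have hsub : ∀ i, (m i).primeFactors ⊆ (∏ i, m i).primeFactors := fun i =>
    Nat.primeFactors_mono (Finset.dvd_prod_of_mem m (Finset.mem_univ i)) hM
  -- the left side, prime by prime over the prime factors of the product
  have hL : (∏ i, ∑ e ∈ (divSet (m i)).filter (· ∈ Nat.smoothNumbers S), thinWeight y e * (e : ℝ) ^ δ) =
      ∏ p ∈ (∏ i, m i).primeFactors, ∏ i,
        ∑ e ∈ (divSet (p ^ (m i).factorization p)).filter (· ∈ Nat.smoothNumbers S),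
          thinWeight y e * (e : ℝ) ^ δ := by
    rw [Finset.prod_comm]
    refine Finset.prod_congr rfl fun i _ => ?_
    rw [twistedSum_eq_factorization_prod y δ S (hm i), Finsupp.prod, Nat.support_factorization]
    refine Finset.prod_subset (hsub i) fun p _ hp => ?_
    have h0 : (m i).factorization p = 0 := by
      rwa [← Finsupp.notMem_support_iff, Nat.support_factorization]
    rw [h0, pow_zero]
    exact twistedSum_one y δ S
  rw [hL, Finsupp.prod, Nat.support_factorization]
  refine Finset.prod_le_prod (fun p _ => Finset.prod_nonneg fun i _ => twistedSum_nonneg hy δ S _) fun p hp => ?_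
  have hpp : p.Prime := Nat.prime_of_mem_primeFactors hp
  have hv : (∏ i, m i).factorization p = ∑ i, (m i).factorization p := by
    rw [Nat.factorization_prod fun i _ => hm i, Finsupp.finsetSum_apply]
  by_cases h1 : (∏ i, m i).factorization p = 1
  · -- a simple prime factor of the product: exactly one slot carries `p`, to the first power
    rw [if_pos h1]
    rw [hv] at h1
    have hne : ∑ i, (m i).factorization p ≠ 0 := by rw [h1]; exact one_ne_zero
    obtain ⟨i₀, -, hi₀⟩ := Finset.exists_ne_zero_of_sum_ne_zero hne
    rw [Finset.sum_eq_add_sum_sdiff_singleton_of_mem (Finset.mem_univ i₀)] at h1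
    have hi₀1 : (m i₀).factorization p = 1 := by omega
    have hrest : ∑ i ∈ Finset.univ \ {i₀}, (m i).factorization p = 0 := by omega
    have hone : ∏ i ∈ Finset.univ \ {i₀},
        ∑ e ∈ (divSet (p ^ (m i).factorization p)).filter (· ∈ Nat.smoothNumbers S),
          thinWeight y e * (e : ℝ) ^ δ = 1 := by
      refine Finset.prod_eq_one fun i hi => ?_
      rw [(Finset.sum_eq_zero_iff_of_nonneg fun _ _ => Nat.zero_le _).1 hrest i hi, pow_zero]
      exact twistedSum_one y δ S
    refine le_of_eq ?_
    rw [Finset.prod_eq_mul_prod_sdiff_singleton_of_mem (Finset.mem_univ i₀), hone, mul_one, hi₀1, pow_one,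
      twistedSum_prime y δ S hpp]
  · -- a repeated prime factor: every slot is at most `y² S^{2δ}`
    rw [if_neg h1]
    calc _ ≤ ∏ _i : Fin k, y ^ 2 * (S : ℝ) ^ (2 * δ) :=
          Finset.prod_le_prod (fun i _ => twistedSum_nonneg hy δ S _) fun i _ =>
            twistedSum_prime_pow_le hy hδ hS hpp _
      _ = (y ^ 2 * (S : ℝ) ^ (2 * δ)) ^ k := by
          rw [Finset.prod_const, Finset.card_univ, Fintype.card_fin]

/-! ### Part (2): the dominating weight at `δ = 2 / log S` is a Nair–Tenenbaum-light weight -/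

/-- `G̃(M) ≥ 0` for `y ≥ 1` (every local factor is `≥ 0`; any `δ`). [folklore] -/
theorem weight_nonneg (k : ℕ) {y : ℝ} (hy : 1 ≤ y) (δ : ℝ) (S M : ℕ) :
    0 ≤ M.factorization.prod fun p v =>
      if v = 1 then (if p < S then 1 + (y - 1) * (p : ℝ) ^ δ else 1) else (y ^ 2 * (S : ℝ) ^ (2 * δ)) ^ k := by
  unfold Finsupp.prod
  refine Finset.prod_nonneg fun p _ => ?_
  dsimp only
  split_ifs
  · exact add_nonneg zero_le_one (mul_nonneg (sub_nonneg.2 hy) (Real.rpow_nonneg (Nat.cast_nonneg p) δ))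
  · exact zero_le_one
  · exact pow_nonneg (mul_nonneg (sq_nonneg y) (Real.rpow_nonneg (Nat.cast_nonneg S) _)) k

/-- A factorization product `M ↦ ∏_{p^v ∥ M} g(p, v)` is multiplicative on coprime arguments (any local data `g`; for
`M = 0` or `N = 0` coprimality forces the other argument to be `1`). [folklore] -/
theorem factorization_prod_mul_of_coprime {β : Type*} [CommMonoid β] (g : ℕ → ℕ → β) {M N : ℕ}
    (h : M.Coprime N) :
    (M * N).factorization.prod g = M.factorization.prod g * N.factorization.prod g := by
  rw [Nat.factorization_mul_of_coprime h, Finsupp.prod_add_index_of_disjoint]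
  simpa only [Nat.support_factorization] using h.disjoint_primeFactors

/-- A factorization product at a prime power `p^v`, `v ≠ 0`, is the local datum `g(p, v)`. [folklore] -/
theorem factorization_prod_prime_pow {β : Type*} [CommMonoid β] (g : ℕ → ℕ → β) {p v : ℕ} (hp : p.Prime)
    (hv : v ≠ 0) : (p ^ v).factorization.prod g = g p v := by
  rw [hp.factorization_pow, Finsupp.prod, Finsupp.support_single p hv, Finset.prod_singleton,
    Finsupp.single_eq_same]

/-- `S^{c / log S} = e^c` for `S ≥ 2`. [folklore] -/
theorem rpow_div_log_self {S : ℕ} (hS : 2 ≤ S) (c : ℝ) : (S : ℝ) ^ (c / Real.log S) = Real.exp c := by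
  have hS0 : (0 : ℝ) < S := by exact_mod_cast (show 0 < S by omega)
  have hlog : Real.log S ≠ 0 := (Real.log_pos (by exact_mod_cast (show 1 < S by omega))).ne'
  rw [Real.rpow_def_of_pos hS0, mul_div_cancel₀ c hlog]

/-- **Part (2), prime powers**: with `δ = 2 / log S`, `S ≥ 2`, `y ≥ 1`, the local data are bounded by
`(y² e⁴)^(k+1)`: `1 + (y − 1) p^δ ≤ 1 + (y − 1) e² ≤ y² e⁴` for `p < S` (`p^δ ≤ S^δ = e²`), `1 ≤ y² e⁴`, and
`(y² S^{2δ})^k = (y² e⁴)^k`. [folklore] -/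
theorem weight_prime_pow_le (k : ℕ) {y : ℝ} (hy : 1 ≤ y) {S : ℕ} (hS : 2 ≤ S) {p : ℕ} (hp : p.Prime) {v : ℕ}
    (hv : 1 ≤ v) :
    ((p ^ v).factorization.prod fun q w =>
        if w = 1 then (if q < S then 1 + (y - 1) * (q : ℝ) ^ (2 / Real.log S) else 1)
        else (y ^ 2 * (S : ℝ) ^ (2 * (2 / Real.log S))) ^ k) ≤ (y ^ 2 * Real.exp 4) ^ (k + 1) := by
  rw [factorization_prod_prime_pow _ hp (by omega)]
  have hE : (1 : ℝ) ≤ Real.exp 4 := Real.one_le_exp (by norm_num)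
  have hyE : 1 ≤ y ^ 2 * Real.exp 4 := one_le_mul_of_one_le_of_one_le (one_le_pow₀ hy) hE
  have h4 : (S : ℝ) ^ (2 * (2 / Real.log S)) = Real.exp 4 := by
    rw [← mul_div_assoc, rpow_div_log_self hS]
    norm_num
  split_ifs with h1 hpS
  · -- `v = 1`, `p < S`
    have hδ : (0 : ℝ) ≤ 2 / Real.log S :=
      div_nonneg zero_le_two (Real.log_nonneg (by exact_mod_cast (show 1 ≤ S by omega)))
    have hpδ : (p : ℝ) ^ (2 / Real.log S) ≤ Real.exp 4 :=
      calc (p : ℝ) ^ (2 / Real.log S) ≤ (S : ℝ) ^ (2 / Real.log S) :=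
            Real.rpow_le_rpow (Nat.cast_nonneg p) (Nat.cast_le.2 hpS.le) hδ
        _ = Real.exp 2 := rpow_div_log_self hS 2
        _ ≤ Real.exp 4 := Real.exp_le_exp.2 (by norm_num)
    calc 1 + (y - 1) * (p : ℝ) ^ (2 / Real.log S) ≤ Real.exp 4 + (y - 1) * Real.exp 4 :=
          add_le_add hE (mul_le_mul_of_nonneg_left hpδ (sub_nonneg.2 hy))
      _ = y * Real.exp 4 := by ring
      _ ≤ y ^ 2 * Real.exp 4 := mul_le_mul_of_nonneg_right (le_self_pow₀ hy two_ne_zero) (Real.exp_nonneg 4)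
      _ ≤ (y ^ 2 * Real.exp 4) ^ (k + 1) := le_self_pow₀ hyE (Nat.succ_ne_zero k)
  · -- `v = 1`, `p ≥ S`
    exact one_le_pow₀ hyE
  · -- `v ≥ 2`
    rw [h4]
    exact pow_le_pow_right₀ hyE (Nat.le_succ k)

/-! ### The registered stub -/

/-- **stub_twistedDivisorSum_domination** (registered signature of the checked skeleton, line
`beta-thinned-root-kernel`): (1) for `y ≥ 1`, `δ ≥ 0`, `S ≥ 1` and non-zero `m₁,…,m_k`, the product of the twisted
smooth divisor sums `∏ᵢ Σ_{e ∣ mᵢ, e S-smooth} h_y(e) e^δ` is at most the multiplicative weight `G̃(∏ᵢ mᵢ)`,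
`G̃(p) = 1 + (y−1)p^δ` (`p < S`), `= 1` (`p ≥ S`), `G̃(p^v) = (y² S^{2δ})^k` (`v ≥ 2`); (2) with `δ = 2/log S`,
`S ≥ 2`: `G̃ ≥ 0`, `G̃(1) = 1`, `G̃` is multiplicative on coprime arguments and `G̃(p^v) ≤ (y² e⁴)^(k+1)` at prime
powers. [folklore] -/
theorem stub_twistedDivisorSum_domination :
    (∀ (k : ℕ) (y : ℝ), 1 ≤ y → ∀ δ : ℝ, 0 ≤ δ → ∀ S : ℕ, 1 ≤ S → ∀ m : Fin k → ℕ, (∀ i, m i ≠ 0) →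
      (∏ i, ∑ e ∈ (divSet (m i)).filter (· ∈ Nat.smoothNumbers S), thinWeight y e * (e : ℝ) ^ δ) ≤
        (∏ i, m i).factorization.prod fun p v =>
          if v = 1 then (if p < S then 1 + (y - 1) * (p : ℝ) ^ δ else 1) else (y ^ 2 * (S : ℝ) ^ (2 * δ)) ^ k) ∧
    (∀ (k : ℕ) (y : ℝ), 1 ≤ y → ∀ S : ℕ, 2 ≤ S →
      (∀ M : ℕ, 0 ≤ M.factorization.prod fun p v =>
          if v = 1 then (if p < S then 1 + (y - 1) * (p : ℝ) ^ (2 / Real.log S) else 1)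
          else (y ^ 2 * (S : ℝ) ^ (2 * (2 / Real.log S))) ^ k) ∧
      ((1 : ℕ).factorization.prod (fun p v =>
          if v = 1 then (if p < S then 1 + (y - 1) * (p : ℝ) ^ (2 / Real.log S) else 1)
          else (y ^ 2 * (S : ℝ) ^ (2 * (2 / Real.log S))) ^ k) = 1) ∧
      (∀ M N : ℕ, M.Coprime N →
        ((M * N).factorization.prod fun p v =>
          if v = 1 then (if p < S then 1 + (y - 1) * (p : ℝ) ^ (2 / Real.log S) else 1)
          else (y ^ 2 * (S : ℝ) ^ (2 * (2 / Real.log S))) ^ k) =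
        (M.factorization.prod fun p v =>
          if v = 1 then (if p < S then 1 + (y - 1) * (p : ℝ) ^ (2 / Real.log S) else 1)
          else (y ^ 2 * (S : ℝ) ^ (2 * (2 / Real.log S))) ^ k) *
        (N.factorization.prod fun p v =>
          if v = 1 then (if p < S then 1 + (y - 1) * (p : ℝ) ^ (2 / Real.log S) else 1)
          else (y ^ 2 * (S : ℝ) ^ (2 * (2 / Real.log S))) ^ k)) ∧
      (∀ p : ℕ, p.Prime → ∀ v : ℕ, 1 ≤ v →
        ((p ^ v).factorization.prod fun q w =>
          if w = 1 then (if q < S then 1 + (y - 1) * (q : ℝ) ^ (2 / Real.log S) else 1)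
          else (y ^ 2 * (S : ℝ) ^ (2 * (2 / Real.log S))) ^ k) ≤ (y ^ 2 * Real.exp 4) ^ (k + 1))) := by
  refine ⟨fun k y hy δ hδ S hS m hm => twistedDivisorSum_le_weight k hy hδ hS m hm, fun k y hy S hS => ?_⟩
  refine ⟨fun M => weight_nonneg k hy _ S M, ?_, fun M N hMN => factorization_prod_mul_of_coprime _ hMN,
    fun p hp v hv => weight_prime_pow_le k hy hS hp hv⟩
  rw [Nat.factorization_one, Finsupp.prod_zero_index]

end

end Summit.Parity.BatemanHorn.Cruxes.SystemLSDRealSegment.BetaThinnedRootKernel
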